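import Summits.Ventures.WeilGRH.TwistedWindowForm
import Summits.RiemannHypothesis.RiemannHypothesis.Theorems.WeilFormatCWindowClosure
import HarnessLib

/-!
# GRH arm (rh-explicit, venture WeilGRH): TWISTED FORMAT C IS COMPLETE —
  `WeilPositivityOnChar χ a` forces the twisted window form to be non-negative on every window function

Cell `rh-explicit`, WEIL TRACK (structure seat weil-3, gen7) for the GRH ARM.  Sequel of
`TwistedWindowForm.lean` (weil-grh-1: the dictionary `weilPositivityOnChar_of_twistedWindowForm_sum_chi_nonneg`,
"twisted Fourier–Galerkin certificate ⟹ rung") and the `χ`-twisted analogue of the structure seat's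
`WeilFormatCWindowClosure.lean` (the case `L = ζ`).  THIS FILE proves the CONVERSE direction for a
Dirichlet character `χ` mod `q ≠ 1` and a window `a > 0`:

* `twistedWindowForm_nonneg_of_weilPositivityOnChar`: if `WeilPositivityOnChar χ a` (Weil positivity of
  `Q_χ` on the smooth cone `C(a)`), then `𝓔^χ_a(u) − M^χ_a‖u‖₂² ≥ 0` for EVERY window function `u` on
  `[-a, a]` which is smooth inside the window (it may JUMP at `±a`: trigonometric windows, Yoshida's `K(a)`,
  the flat window `𝟙_{[-a,a]}`, `cosh(x/2)𝟙_{[-a,a]}`, …);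
* `weilPositivityOnChar_iff_twistedWindowForm_sum_chi_nonneg`: **`WeilPositivityOnChar χ a ↔ ∀ N c,
  0 ≤ 𝓔^χ_a(Σ_{|n|≤N} c_nχ_n) − M^χ_a‖Σ_{|n|≤N} c_nχ_n‖₂²`** — a `χ`-rung holds iff ALL twisted Gram
  truncations are positive semidefinite (twisted format C loses nothing), and
  `weilPositivityOnChar_iff_forall_mem_K` (positivity on `C(a)` and on `K(a)` are equivalent);
* `not_weilPositivityOnChar_of_twistedWindowForm_neg`: ONE window function with a negative twisted window
  form refutes the rung — the soundness of NEGATIVE twisted certificates, and the entry point of the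
  structure seat's flat-test inequality (`TwistedFlatTest.lean`: what a `χ`-rung EXCLUDES).

Method (as for `ζ`, Yoshida 1992 §0 "we can extend ( , ) to K(a)"): cut `u` off smoothly INSIDE the window,
`g_k = η_k·u ∈ C(a)` (plateaus of `WeilFormatCWindowCutoff.lean`, transition width `ε_k → 0`), `g_k → u`
off `{±a}`, increments `D_t(g_k) ≤ K₁t` on `(0,1]` and `≤ 8aS₀²` beyond uniformly in `k`
(`weilIncrement_cutoff_le`); the twisted increments `D^w₀_t(g_k) → D^w₀_t(u)` and the parity-`κ` archimedean
energy converge by dominated convergence (`ρ_κ ≤ ρ_0`, `weilArchDensityPar_nonneg_le`), and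
`𝓔^χ_a(g_k) − M^χ_a‖g_k‖₂² = Re Q_χ(g_k) ≥ 0` (`re_weilQuadraticChar_eq_markov_of_ne_one`) passes to the limit.

No definitions, no named facts, RH/GRH-free; `--supports stmt-RiemannHypothesis-0098`.

## References

* H. Yoshida, *On Hermitian forms attached to zeta functions*, Adv. Stud. Pure Math. 21 (1992) 281–325,
  §0 (extension of the form to `K(a)`), §3 (the basis `χ_n`). [Yoshida1992]
* A. Weil, *Sur les "formules explicites" de la théorie des nombres premiers* (1952), (11) pp. 261–262 and
  the «lemme» p. 262. [Weil1952FormulesExplicites]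
-/

set_option autoImplicit false

noncomputable section

open Complex Filter Set MeasureTheory
open scoped Real Topology ComplexConjugate ContDiff ArithmeticFunction.vonMangoldt

namespace Summit.Ventures.WeilGRH

open Literature.NumberTheory.LFunctions
open Literature.NumberTheory.LFunctions.Yoshida1992 (modes chi chiCore contDiff_chiCore)
open Summit.RiemannHypothesis.RiemannHypothesis.Theorems.WeilFormatC

variable {q : ℕ} {a : ℝ} {φ : ℝ → ℂ} {u : ℕ → ℝ → ℂ} {S₀ : ℝ}

/-! ## Twisted increments and the parity-`κ` archimedean energy along a.e.-convergent window families -/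

/-- Pointwise bound for the twisted increment integrand of a bounded function vanishing off `[-a,a]`:
`‖v(x+t) − w₀ v(x)‖² ≤ 2S₀²(𝟙_{[-a,a]}(x+t) + ‖w₀‖² 𝟙_{[-a,a]}(x))`. -/
private theorem norm_sub_twist_sq_le {v : ℝ → ℂ} (hz : ∀ x, x ∉ Icc (-a) a → v x = 0)
    (hb : ∀ x, ‖v x‖ ≤ S₀) (w₀ : ℂ) (t x : ℝ) :
    ‖v (x + t) - w₀ * v x‖ ^ 2 ≤
      2 * S₀ ^ 2 * ((Icc (-a) a).indicator 1 (x + t) + ‖w₀‖ ^ 2 * (Icc (-a) a).indicator 1 x) := by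
  have hS₀ : 0 ≤ S₀ := (norm_nonneg _).trans (hb 0)
  have key : ∀ y, ‖v y‖ ^ 2 ≤ S₀ ^ 2 * (Icc (-a) a).indicator 1 y := by
    intro y
    by_cases hy : y ∈ Icc (-a) a
    · rw [indicator_of_mem hy, Pi.one_apply, mul_one]
      have := hb y
      have h0 : 0 ≤ ‖v y‖ := norm_nonneg _
      nlinarith
    · rw [hz y hy, indicator_of_notMem hy, norm_zero, mul_zero]
      simp
  have htri : ‖v (x + t) - w₀ * v x‖ ^ 2 ≤ 2 * ‖v (x + t)‖ ^ 2 + 2 * (‖w₀‖ ^ 2 * ‖v x‖ ^ 2) := by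
    have h := norm_sub_le (v (x + t)) (w₀ * v x)
    rw [norm_mul] at h
    have h0 : 0 ≤ ‖v (x + t) - w₀ * v x‖ := norm_nonneg _
    nlinarith [sq_nonneg (‖v (x + t)‖ - ‖w₀‖ * ‖v x‖), norm_nonneg w₀, norm_nonneg (v x)]
  have k1 := key (x + t)
  have k2 := mul_le_mul_of_nonneg_left (key x) (sq_nonneg ‖w₀‖)
  nlinarith

/-- **`D^w₀_t(u_N) → D^w₀_t(φ)` along an a.e.-convergent bounded window family** (`u_N` measurable,
vanishing off `[-a,a]`, `‖u_N‖ ≤ S₀`, `u_N → φ` almost everywhere; dominated convergence on the window). -/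
theorem tendsto_weilTwistIncrement_of_ae_tendsto (hum : ∀ N, Measurable (u N))
    (huz : ∀ N x, x ∉ Icc (-a) a → u N x = 0) (hub : ∀ N x, ‖u N x‖ ≤ S₀)
    (hpt : ∀ᵐ x : ℝ, Tendsto (fun N ↦ u N x) atTop (𝓝 (φ x))) (w₀ : ℂ) (t : ℝ) :
    Tendsto (fun N ↦ weilTwistIncrement w₀ (u N) t) atTop (𝓝 (weilTwistIncrement w₀ φ t)) := by
  have hpt' : ∀ᵐ x : ℝ, Tendsto (fun N ↦ u N (x + t)) atTop (𝓝 (φ (x + t))) :=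
    ae_comp_add_right hpt t
  unfold weilTwistIncrement
  refine tendsto_integral_of_dominated_convergence
    (fun x ↦ 2 * S₀ ^ 2 * ((Icc (-a) a).indicator 1 (x + t) + ‖w₀‖ ^ 2 * (Icc (-a) a).indicator 1 x))
    (fun N ↦ ((((hum N).comp (measurable_id.add_const t)).sub ((hum N).const_mul w₀)).norm.pow_const 2
      |>.aestronglyMeasurable)) ?_ (fun N ↦ Eventually.of_forall fun x ↦ ?_)
    ((hpt'.and hpt).mono fun x hx ↦ ((hx.1.sub (hx.2.const_mul w₀)).norm).pow 2)
  · refine Integrable.const_mul (Integrable.add ?_ ?_) _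
    · exact ((integrable_indicator_iff measurableSet_Icc).2
        (integrableOn_const (by simp [Real.volume_Icc]))).comp_add_right t
    · exact ((integrable_indicator_iff measurableSet_Icc).2
        (integrableOn_const (by simp [Real.volume_Icc]))).const_mul _
  · rw [Real.norm_of_nonneg (by positivity)]
    exact norm_sub_twist_sq_le (huz N) (hub N) w₀ t x

/-- **The parity-`κ` archimedean energy converges under an external majorant**: if `D_t(u_N) ≤ m(t)` for
`t > 0` with `weilArchDensity·m` integrable on `(0, ∞)` and `D_t(u_N) → D_t(φ)` for every `t > 0`, then
`∫₀^∞ ρ_κ(t) D_t(u_N) dt → ∫₀^∞ ρ_κ(t) D_t(φ) dt` (`ρ_κ ≤ ρ_0 = weilArchDensity`). -/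
theorem tendsto_archIntegralPar_of_le (hum : ∀ N, Measurable (u N)) {m : ℝ → ℝ}
    (hm : IntegrableOn (fun t ↦ weilArchDensity t * m t) (Ioi 0))
    (hdom : ∀ N t, 0 < t → weilIncrement (u N) t ≤ m t)
    (hinc : ∀ t, 0 < t → Tendsto (fun N ↦ weilIncrement (u N) t) atTop (𝓝 (weilIncrement φ t)))
    (κ : ℕ) :
    Tendsto (fun N ↦ ∫ t in Ioi (0 : ℝ), weilArchDensityPar κ t * weilIncrement (u N) t) atTop
      (𝓝 (∫ t in Ioi (0 : ℝ), weilArchDensityPar κ t * weilIncrement φ t)) := by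
  refine tendsto_integral_of_dominated_convergence (fun t ↦ weilArchDensity t * m t)
    (fun N ↦ ((measurable_weilArchDensityPar κ).mul (measurable_weilIncrement (hum N))).aestronglyMeasurable)
    hm (fun N ↦ ?_) ?_
  · refine (ae_restrict_iff' measurableSet_Ioi).2 (Eventually.of_forall fun t ht ↦ ?_)
    obtain ⟨h0, hle⟩ := weilArchDensityPar_nonneg_le κ ht
    have hD : 0 ≤ weilIncrement (u N) t := weilIncrement_nonneg _ _
    rw [Real.norm_of_nonneg (mul_nonneg h0 hD)]
    exact (mul_le_mul_of_nonneg_right hle hD).trans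
      (mul_le_mul_of_nonneg_left (hdom N t ht) (weilArchDensity_pos ht).le)
  · exact (ae_restrict_iff' measurableSet_Ioi).2
      (Eventually.of_forall fun t ht ↦ (hinc t ht).const_mul _)

/-- **The twisted window form converges along an a.e.-convergent bounded window family with an
archimedean majorant**: `𝓔^χ_b(u_N) − M^χ_b‖u_N‖₂² → 𝓔^χ_b(φ) − M^χ_b‖φ‖₂²` (any `χ`, any window
parameter `b`). -/
theorem tendsto_twistedWindowForm_of_ae_tendsto_of_le (χ : DirichletCharacter ℂ q)
    (hum : ∀ N, Measurable (u N))
    (huz : ∀ N x, x ∉ Icc (-a) a → u N x = 0) (hub : ∀ N x, ‖u N x‖ ≤ S₀)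
    (hpt : ∀ᵐ x : ℝ, Tendsto (fun N ↦ u N x) atTop (𝓝 (φ x))) {m : ℝ → ℝ}
    (hm : IntegrableOn (fun t ↦ weilArchDensity t * m t) (Ioi 0))
    (hdom : ∀ N t, 0 < t → weilIncrement (u N) t ≤ m t) (b : ℝ) :
    Tendsto (fun N ↦ weilDirichletEnergyChar χ b (u N) -
        weilMarkovConstantChar χ b * ∫ x : ℝ, ‖u N x‖ ^ 2) atTop
      (𝓝 (weilDirichletEnergyChar χ b φ - weilMarkovConstantChar χ b * ∫ x : ℝ, ‖φ x‖ ^ 2)) := by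
  have hinc : ∀ t, Tendsto (fun N ↦ weilIncrement (u N) t) atTop (𝓝 (weilIncrement φ t)) :=
    tendsto_weilIncrement_of_ae_tendsto hum huz hub hpt
  have htw : ∀ (w₀ : ℂ) (t : ℝ),
      Tendsto (fun N ↦ weilTwistIncrement w₀ (u N) t) atTop (𝓝 (weilTwistIncrement w₀ φ t)) :=
    tendsto_weilTwistIncrement_of_ae_tendsto hum huz hub hpt
  have harch := tendsto_archIntegralPar_of_le hum hm hdom (fun t _ ↦ hinc t) (charParity χ)
  have hprime : Tendsto (fun N ↦ ∑ n ∈ weilPrimeIndex b, (Λ n : ℝ) / Real.sqrt n *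
      weilTwistIncrement (conj (χ (n : ZMod q))) (u N) (Real.log n)) atTop
      (𝓝 (∑ n ∈ weilPrimeIndex b, (Λ n : ℝ) / Real.sqrt n *
        weilTwistIncrement (conj (χ (n : ZMod q))) φ (Real.log n))) :=
    tendsto_finsetSum _ fun n _ ↦ (htw _ _).const_mul _
  have hnorm := tendsto_integral_norm_sq_of_ae_tendsto hum huz hub hpt
  unfold weilDirichletEnergyChar
  exact (hprime.add harch).sub (hnorm.const_mul _)

/-! ## The converse of the twisted dictionary -/

/-- **`WeilPositivityOnChar χ a` forces the twisted window form to be non-negative on every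
smooth-inside window function.**  Let `q ≠ 1`, `a > 0`, `WeilPositivityOnChar χ a`, and let `u` be a
window function on `[-a, a]` (measurable, vanishing off the window, bounded, Lipschitz on the closed
window) which agrees on `[-a, a]` with a smooth `f : ℝ → ℂ` (so `u` may JUMP at `±a`).  Then
`0 ≤ 𝓔^χ_a(u) − M^χ_a‖u‖₂²`. -/
theorem twistedWindowForm_nonneg_of_weilPositivityOnChar (hq : q ≠ 1) (χ : DirichletCharacter ℂ q)
    (ha : 0 < a) (hW : WeilPositivityOnChar χ a) {u f : ℝ → ℂ}
    (hu : IsWindowFunction a u) (hf : ContDiff ℝ ∞ f) (huf : ∀ x ∈ Icc (-a) a, u x = f x) :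
    0 ≤ weilDirichletEnergyChar χ a u - weilMarkovConstantChar χ a * ∫ x : ℝ, ‖u x‖ ^ 2 := by
  obtain ⟨hum, huz, ⟨S₀, hS₀⟩, ⟨S₁', hS₁'⟩⟩ := hu
  set S₁ := max S₁' 0 with hS₁def
  have hS₁0 : 0 ≤ S₁ := le_max_right _ _
  have hS₁ : ∀ x y, x ∈ Icc (-a) a → y ∈ Icc (-a) a → ‖u y - u x‖ ≤ S₁ * |y - x| := fun x y hx hy ↦
    (hS₁' x y hx hy).trans (mul_le_mul_of_nonneg_right (le_max_left _ _) (abs_nonneg _))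
  have hS₀0 : 0 ≤ S₀ := (norm_nonneg _).trans (hS₀ 0)
  obtain ⟨C, hC0, hC⟩ := exists_lipschitz_smoothTransition
  -- transition widths `ε_k = a/(2(k+2)) → 0`, `2ε_k ≤ a`
  set ε : ℕ → ℝ := fun k ↦ a / ((k : ℝ) + 2) / 2 with hεdef
  have hε : ∀ k, 0 < ε k := fun k ↦ by positivity
  have h2ε : ∀ k, 2 * ε k ≤ a := fun k ↦ by
    have : a / ((k : ℝ) + 2) ≤ a := div_le_self ha.le (by linarith [(Nat.cast_nonneg k : (0 : ℝ) ≤ k)])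
    show 2 * (a / ((k : ℝ) + 2) / 2) ≤ a
    linarith
  have hεto : Tendsto ε atTop (𝓝 0) := by
    have h1 : Tendsto (fun k : ℕ ↦ a / ((k : ℝ) + 2)) atTop (𝓝 0) :=
      tendsto_const_nhds.div_atTop (tendsto_atTop_add_const_right _ _ tendsto_natCast_atTop_atTop)
    simpa [hεdef] using h1.div_const 2
  choose η hηs hη01 hη1 hη0 hηL using fun k ↦ exists_smooth_plateau (a := a) (hε k) hC
  have hηm : ∀ k, Measurable (η k) := fun k ↦ (hηs k).continuous.measurable
  -- the approximants `g_k = η_k · f = η_k · u ∈ C(a)`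
  set g : ℕ → ℝ → ℂ := fun k x ↦ (η k x : ℂ) * f x with hgdef
  have hgu : ∀ k x, g k x = (η k x : ℂ) * u x := by
    intro k x
    by_cases hx : x ∈ Icc (-a) a
    · simp only [hgdef, huf x hx]
    · have hxa : a - ε k ≤ |x| := by
        have : a < |x| := lt_abs_of_not_mem_Icc_window hx
        linarith [hε k]
      simp only [hgdef, hη0 k x hxa, Complex.ofReal_zero, zero_mul]
  have hgu' : ∀ k, g k = fun x ↦ (η k x : ℂ) * u x := fun k ↦ funext (hgu k)
  have hgz : ∀ k x, x ∉ Icc (-a) a → g k x = 0 := fun k x hx ↦ by rw [hgu, huz x hx, mul_zero]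
  have hgb : ∀ k x, ‖g k x‖ ≤ S₀ := fun k x ↦ by
    rw [hgu, norm_mul, Complex.norm_real, Real.norm_eq_abs, abs_of_nonneg (hη01 k x).1]
    calc η k x * ‖u x‖ ≤ 1 * S₀ := by
          gcongr
          · exact (hη01 k x).2
          · exact hS₀ x
      _ = S₀ := one_mul _
  have hofR : ContDiff ℝ ∞ (fun x : ℝ ↦ (x : ℂ)) := Complex.ofRealCLM.contDiff
  have hgsmooth : ∀ k, ContDiff ℝ ∞ (g k) := fun k ↦ (hofR.comp (hηs k)).mul hf
  have hgm : ∀ k, Measurable (g k) := fun k ↦ (hgsmooth k).continuous.measurable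
  have hgsupp : ∀ k, tsupport (g k) ⊆ Icc (-a) a := fun k ↦
    closure_minimal (fun x hx ↦ by_contra fun h ↦ hx (hgz k x h)) isClosed_Icc
  have hgtest : ∀ k, IsWeilTest (g k) := fun k ↦
    ⟨hgsmooth k, HasCompactSupport.intro isCompact_Icc (hgz k)⟩
  have hpos : ∀ k, 0 ≤ weilDirichletEnergyChar χ a (g k) -
      weilMarkovConstantChar χ a * ∫ x : ℝ, ‖g k x‖ ^ 2 := fun k ↦ by
    rw [← re_weilQuadraticChar_eq_markov_of_ne_one hq χ (hgtest k) (hgsupp k)]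
    exact hW (g k) (hgtest k) (hgsupp k)
  -- almost-everywhere convergence `g_k → u` (everywhere off `{a, −a}`)
  have hpt : ∀ᵐ x : ℝ, Tendsto (fun k ↦ g k x) atTop (𝓝 (u x)) := by
    have hnull : ∀ᵐ x : ℝ, x ∈ ({a, -a} : Set ℝ)ᶜ :=
      compl_mem_ae_iff.2 ((Set.toFinite _).measure_zero _)
    refine hnull.mono fun x hx ↦ ?_
    simp only [mem_compl_iff, mem_insert_iff, mem_singleton_iff, not_or] at hx
    rcases lt_or_ge a |x| with hxa | hxa
    · have hx' : x ∉ Icc (-a) a := fun h ↦ by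
        have := abs_le.2 ⟨h.1, h.2⟩; linarith
      rw [huz x hx']
      exact tendsto_const_nhds.congr' (Eventually.of_forall fun k ↦ (hgz k x hx').symm)
    · have hlt : |x| < a := lt_of_le_of_ne hxa fun h ↦ by
        rcases (abs_eq ha.le).1 h with h' | h'
        · exact hx.1 h'
        · exact hx.2 h'
      have hr : (0 : ℝ) < (a - |x|) / 2 := by linarith
      have hev : ∀ᶠ k in atTop, u x = g k x := by
        filter_upwards [hεto.eventually (gt_mem_nhds hr)] with k hk
        rw [hgu, hη1 k x (by linarith), Complex.ofReal_one, one_mul]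
      exact tendsto_const_nhds.congr' hev
  -- the archimedean majorant, uniform in `k`
  set Λ' : ℝ := a * S₁ + 2 * C * S₀ with hΛ'
  set K₁ : ℝ := 4 * a * S₁ ^ 2 + 4 * S₀ ^ 2 + 8 * (2 * Λ' ^ 2 + 10 * S₀ ^ 2) with hK₁
  set K₂ : ℝ := 8 * a * S₀ ^ 2 with hK₂
  set cst : ℝ := max (K₁ / 2) (K₂ / (8 * a)) with hcst
  have hdom : ∀ k t, 0 < t → weilIncrement (g k) t ≤ cst * (if t ≤ 1 then 2 * t else 8 * a) := by
    intro k t ht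
    by_cases ht1 : t ≤ 1
    · rw [if_pos ht1]
      have hmain := weilIncrement_cutoff_le ha (hε k) (h2ε k) hum huz hS₀ hS₁ hS₁0 hC0 (hηm k) (hη01 k)
        (hη1 k) (hηL k) ht
      rw [← hgu' k] at hmain
      have ht2 : t ^ 2 ≤ t := by nlinarith
      have h3 : 4 * a * S₁ ^ 2 * t ^ 2 ≤ 4 * a * S₁ ^ 2 * t := mul_le_mul_of_nonneg_left ht2 (by positivity)
      calc weilIncrement (g k) t ≤ K₁ * t := by
            rw [hK₁, hΛ']; linarith [hmain, h3]
        _ = K₁ / 2 * (2 * t) := by ring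
        _ ≤ cst * (2 * t) := by gcongr; exact le_max_left _ _
    · rw [if_neg ht1]
      calc weilIncrement (g k) t ≤ 8 * a * S₀ ^ 2 :=
            weilIncrement_le_window_const ha.le (hgm k) (hgz k) (hgb k) t
        _ = K₂ / (8 * a) * (8 * a) := by rw [hK₂]; field_simp
        _ ≤ cst * (8 * a) := by gcongr; exact le_max_right _ _
  have hM : IntegrableOn (fun t ↦ weilArchDensity t * (cst * (if t ≤ 1 then 2 * t else 8 * a))) (Ioi 0) := by
    have h0 := integrableOn_archBound ha.le (1 : ℝ) (0 : ℝ)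
    have h1 : IntegrableOn (fun t : ℝ ↦ weilArchDensity t * (if t ≤ 1 then 2 * t else 8 * a)) (Ioi 0) :=
      h0.congr_fun (fun t _ ↦ by norm_num) measurableSet_Ioi
    exact IntegrableOn.congr_fun (h1.const_mul cst) (fun t _ ↦ by ring) measurableSet_Ioi
  exact ge_of_tendsto' (tendsto_twistedWindowForm_of_ae_tendsto_of_le χ hgm hgz hgb hpt hM hdom a) hpos

/-- **Every trigonometric window has non-negative twisted window form under `WeilPositivityOnChar χ a`**
(`q ≠ 1`, `a > 0`; any finite set of modes, `χ_n = chi a n = (2a)^{-1/2}e^{iπnx/a}𝟙_{[-a,a]}`). -/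
theorem twistedWindowForm_sum_smul_chi_nonneg_of_weilPositivityOnChar (hq : q ≠ 1)
    (χ : DirichletCharacter ℂ q) (ha : 0 < a) (hW : WeilPositivityOnChar χ a)
    (s : Finset ℤ) (c : ℤ → ℂ) :
    0 ≤ weilDirichletEnergyChar χ a (∑ n ∈ s, c n • chi a n) -
      weilMarkovConstantChar χ a * ∫ x : ℝ, ‖(∑ n ∈ s, c n • chi a n) x‖ ^ 2 := by
  refine twistedWindowForm_nonneg_of_weilPositivityOnChar hq χ ha hW
    (f := fun x ↦ ∑ n ∈ s, c n • chiCore a n x)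
    (IsWindowFunction.sum s c fun n _ ↦ isWindowFunction_chi ha n)
    (ContDiff.sum fun n _ ↦ (contDiff_chiCore a n).const_smul (c n)) fun x hx ↦ ?_
  simp only [Finset.sum_apply, Pi.smul_apply, chi, indicator_of_mem hx]

/-- **Positivity on `C(a)` ⟹ positivity of the twisted window form on all of `K(a)`** (Yoshida's
extension of the form to `K(a)`, 1992 §0, for `L(s, χ)`): `0 ≤ 𝓔^χ_a(φ) − M^χ_a‖φ‖₂²` for every `φ ∈ K(a)`
under `WeilPositivityOnChar χ a` (`q ≠ 1`, `a > 0`). -/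
theorem twistedWindowForm_nonneg_of_weilPositivityOnChar_of_mem_K (hq : q ≠ 1)
    (χ : DirichletCharacter ℂ q) (ha : 0 < a) (hW : WeilPositivityOnChar χ a) {φ : ℝ → ℂ}
    (hφ : φ ∈ Yoshida1992.K a) :
    0 ≤ weilDirichletEnergyChar χ a φ - weilMarkovConstantChar χ a * ∫ x : ℝ, ‖φ x‖ ^ 2 := by
  have hwin := isWindowFunction_of_mem_K hφ
  obtain ⟨f, hf, -, hφf, -⟩ := hφ
  exact twistedWindowForm_nonneg_of_weilPositivityOnChar hq χ ha hW hwin hf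
    fun x hx ↦ hφf x (abs_le.2 ⟨hx.1, hx.2⟩)

/-- **`WeilPositivityOnChar χ a` ⟺ the twisted window form is non-negative on `K(a)`** (`q ≠ 1`, `a > 0`):
positivity of `Q_χ` on the cone `C(a)` and of the twisted window form on Yoshida's larger space `K(a)` are
EQUIVALENT. -/
theorem weilPositivityOnChar_iff_forall_mem_K (hq : q ≠ 1) (χ : DirichletCharacter ℂ q) (ha : 0 < a) :
    WeilPositivityOnChar χ a ↔ ∀ φ ∈ Yoshida1992.K a,
      0 ≤ weilDirichletEnergyChar χ a φ - weilMarkovConstantChar χ a * ∫ x : ℝ, ‖φ x‖ ^ 2 :=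
  ⟨fun hW _ hφ ↦ twistedWindowForm_nonneg_of_weilPositivityOnChar_of_mem_K hq χ ha hW hφ,
    fun h ↦ weilPositivityOnChar_of_twistedWindowForm_sum_chi_nonneg hq χ ha fun _ c ↦
      h _ (Submodule.sum_mem _ fun n _ ↦ Submodule.smul_mem _ (c n) (Yoshida1992.chi_mem_K a n))⟩

/-- **TWISTED FORMAT C IS COMPLETE**: for `q ≠ 1` and `a > 0`, `WeilPositivityOnChar χ a` holds if and
only if the twisted window form is non-negative on every trigonometric window `Σ_{|n|≤N} c_n χ_n` (the
dictionary `weilPositivityOnChar_of_twistedWindowForm_sum_chi_nonneg` and its converse): a `χ`-rung holds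
iff ALL truncations of the twisted Gram form are positive semidefinite. -/
theorem weilPositivityOnChar_iff_twistedWindowForm_sum_chi_nonneg (hq : q ≠ 1)
    (χ : DirichletCharacter ℂ q) (ha : 0 < a) :
    WeilPositivityOnChar χ a ↔ ∀ (N : ℕ) (c : ℤ → ℂ),
      0 ≤ weilDirichletEnergyChar χ a (∑ n ∈ modes N, c n • chi a n) -
        weilMarkovConstantChar χ a * ∫ x : ℝ, ‖(∑ n ∈ modes N, c n • chi a n) x‖ ^ 2 :=
  ⟨fun hW N c ↦ twistedWindowForm_sum_smul_chi_nonneg_of_weilPositivityOnChar hq χ ha hW (modes N) c,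
    weilPositivityOnChar_of_twistedWindowForm_sum_chi_nonneg hq χ ha⟩

/-- **Soundness of NEGATIVE twisted certificates**: one smooth-inside window function `u` on `[-a, a]`
with `𝓔^χ_a(u) − M^χ_a‖u‖₂² < 0` refutes `WeilPositivityOnChar χ a` (`q ≠ 1`, `a > 0`). -/
theorem not_weilPositivityOnChar_of_twistedWindowForm_neg (hq : q ≠ 1) (χ : DirichletCharacter ℂ q)
    (ha : 0 < a) {u f : ℝ → ℂ} (hu : IsWindowFunction a u) (hf : ContDiff ℝ ∞ f)
    (huf : ∀ x ∈ Icc (-a) a, u x = f x)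
    (h : weilDirichletEnergyChar χ a u - weilMarkovConstantChar χ a * ∫ x : ℝ, ‖u x‖ ^ 2 < 0) :
    ¬ WeilPositivityOnChar χ a :=
  fun hW ↦ not_lt.2 (twistedWindowForm_nonneg_of_weilPositivityOnChar hq χ ha hW hu hf huf) h

/-- **Soundness of NEGATIVE twisted Fourier–Galerkin certificates**: one coefficient vector on finitely many
modes with a negative twisted window form refutes `WeilPositivityOnChar χ a`. -/
theorem not_weilPositivityOnChar_of_twistedWindowForm_sum_chi_neg (hq : q ≠ 1)
    (χ : DirichletCharacter ℂ q) (ha : 0 < a) {s : Finset ℤ} {c : ℤ → ℂ}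
    (h : weilDirichletEnergyChar χ a (∑ n ∈ s, c n • chi a n) -
      weilMarkovConstantChar χ a * ∫ x : ℝ, ‖(∑ n ∈ s, c n • chi a n) x‖ ^ 2 < 0) :
    ¬ WeilPositivityOnChar χ a :=
  fun hW ↦ not_lt.2 (twistedWindowForm_sum_smul_chi_nonneg_of_weilPositivityOnChar hq χ ha hW s c) h

end Summit.Ventures.WeilGRH

end
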